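import Summits.BirchSwinnertonDyer.BirchSwinnertonDyer.Theorems.AlignedTransportAtTwoMainConjectureOfRankZeroBSDAtTwoFineRoadRealKummerTwistLetters
import Summits.BirchSwinnertonDyer.BirchSwinnertonDyer.Theorems.AlignedTransportAtTwoMainConjectureOfRankZeroBSDAtTwoFineRoadRealKummerCongruence
import Summits.BirchSwinnertonDyer.BirchSwinnertonDyer.Theorems.AlignedTransportAtTwoMainConjectureOfRankZeroBSDAtTwoFineRoadRealKummerNegDisc
import HarnessLib

/-!
# Quadratic-twist invariance at `p = 2` of stub T's conclusion «`X(E/ℚ_∞)` is `Λ`-torsion with `μ₂ = 0`» (as finiteness of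
# `Sel_{2^∞}(E/ℚ_∞)[2]`), modulo the printed `im κ_𝔭 ⊇ L_𝔭`: transfer along signed `2^∞`-congruences; complex conjugation and `√d`

Cell `bsd-f1-sign2`, WIDTH-5 attach seat `bsd-line-att-p5` (gen 11) on line `birth` of crux C2 stmt-BirchSwinnertonDyer-22298
`MainConjectureOfRankZeroBSDAtTwo`; sequel of `…FineRoadRealKummerTwistLetters` (this gen) and of att-p5 g10 `…RealKummerCongruence` /
`…RealKummerNegDisc`. A `--supports 22298 --as helper` file. HONEST FRAMING: THEOREMS ONLY — no definition, no named fact, no `sorry`;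
C2-NEUTRAL (stub T stays OPEN; verdict «blocked-on GreenbergMuConjectureIrreducible» untouched); BSD is NOT proved by any of this. The
equivalences below are modulo ONE printed local fact, `GreenbergVatsal2000.imKummer_ge_greenbergCondition_at_p` (Greenberg LNM 1716
Props. 2.2/2.4 at `p = 2`), carried as the explicit hypothesis `hGV` exactly as in att-p5 g10.

WHAT.
* §5 `smul_geomSqrt_of_isComplexConjugation_of_pos/neg`: a complex conjugation `c ∈ Γ_ℚ` (under some `ι : ℚ̄ → ℂ`) FIXES `√d` for
  `d > 0` and NEGATES it for `d < 0` (`(ι√d)² = d`); hence every element of the real decomposition group fixes `√d` when `d > 0`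
  (`smul_geomSqrt_of_mem_decompInf_of_pos`) and every non-trivial one negates it when `d < 0`.
* §6 **`finite_twoTorsion_selmerInfty_iff_of_signedPrimaryIso_of_GV`** (`Δ_V, Δ_W > 0`): along a sign-equivariant
  `e : V[2^∞] ≃+ W[2^∞]` between globally minimal good-ordinary-at-`2` curves that is EQUIVARIANT on the real decomposition group,
  `Sel_{2^∞}(V/ℚ_∞)[2]` finite ⟺ `Sel_{2^∞}(W/ℚ_∞)[2]` finite (the letters are matched by the sibling file; then att-p5 g10's transfer);
  **`…_of_Δ_neg`** (`Δ_V, Δ_W < 0`): the same for EVERY sign-equivariant `e` (no real letter on the `Δ < 0` half-cell).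
* **`finite_twoTorsion_selmerInfty_iff_of_model_twist_of_pos_of_GV`**: `V` globally minimal good ordinary at `2`, `Δ_V > 0`, `W` a globally
  minimal model of `V^{(d)}` again good ordinary at `2`, `d > 0` ⟹ (T-conclusion for `V` ⟺ T-conclusion for `W`);
  **`finite_twoTorsion_selmerInfty_iff_of_model_twist_of_Δ_neg_of_GV`**: `Δ_V < 0`, ANY `d ≠ 0`. So on the seed cell of crux C2
  «`X` torsion ∧ `μ₂ = 0`» is CONSTANT on admissible quadratic-twist families — on `Δ < 0` all of them, on `Δ > 0` the positive ones; for
  negative twists on `Δ > 0` the twisting congruence sends the Kummer line to the ANTI-Kummer line (sibling §4), and the transfer theorem does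
  not apply. A `p = 2` phenomenon (`E^{(d)}[2] ≅ E[2]`); GV 2000 Thm 1.4 (`p` odd) never relates a curve to its twists. Reading for the
  cell («± object at 2»): the `μ₂`-part of T is blind to the quadratic character EXCEPT through its sign at the real place.

References: R. Greenberg, V. Vatsal, Invent. Math. 142 (2000) Thm. 1.4, §2 p. 26; R. Greenberg, LNM 1716 (1999) §2 Props. 2.2–2.4, §5
pp. 168, 174; K. Matsuno, *Construction of elliptic curves with large Iwasawa λ-invariants and large Tate–Shafarevich groups*,
Manuscripta Math. 122 (2007) / IJNT 4 (2008) §4 (the archimedean term `Σ₊` at `p = 2`); J.-P. Serre, *Abelian ℓ-adic representations*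
(1968) I §2.2; J. H. Silverman, *AEC* 2nd ed. (2009) X.5 Cor. 5.4; crux workfile `RELAXED-COEFFICIENTS-att-p5.md` §9–§10.
-/

set_option autoImplicit false
-- the Theorems namespace of this sub repeats the summit name by design (D-0017 nested layout)
set_option linter.dupNamespace false

noncomputable section

open scoped Classical

namespace Summit.BirchSwinnertonDyer.BirchSwinnertonDyer.Theorems.AlignedTransportAtTwoFineRoad.RealKummerTwist

open WeierstrassCurve NumberField IsDedekindDomain Field Literature.NumberTheory.EllipticCurves
  Literature.NumberTheory.EllipticCurves.GreenbergSelmer Literature.NumberTheory.GaloisRepresentations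
  Summit.BirchSwinnertonDyer.BirchSwinnertonDyer.Theorems.AlignedTransportAtTwoFineRoad
  Summit.BirchSwinnertonDyer.BirchSwinnertonDyer.Theorems.AlignedTransportAtTwoFineRoad.RealKummerTwistLetters
  Summit.BirchSwinnertonDyer.Rank1Residual.X2 Summit.BirchSwinnertonDyer.Rank1Residual.X2.GreenbergVatsalReductionDatum
  Summit.BirchSwinnertonDyer.Rank1Residual.Additive

/-! ## §5 A complex conjugation fixes `√d` for `d > 0` and negates it for `d < 0` -/

section Sqrt

/-- For a complex conjugation `c ∈ Γ_ℚ` (under some `ι : ℚ̄ → ℂ`) and `d > 0`: `c√d = √d` (`ι√d` is real, its square being the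
positive rational `d`). [cite: SerreAbelianLadic1968, Ch. I §2.2] -/
theorem smul_geomSqrt_of_isComplexConjugation_of_pos {φ : ℚ →+* ℝ} {c : absoluteGaloisGroup ℚ} (hc : IsComplexConjugation φ c)
    {d : ℚ} (hd : 0 < d) : c • geomSqrt d = geomSqrt d := by
  obtain ⟨ι, -, hι⟩ := isComplexConjugation_iff.1 hc
  have hsq : ι (geomSqrt d) ^ 2 = (d : ℂ) := by
    rw [← map_pow, geomSqrt_sq]
    simp only [eq_ratCast, map_ratCast]
  have hre : (ι (geomSqrt d)).re * (ι (geomSqrt d)).re - (ι (geomSqrt d)).im * (ι (geomSqrt d)).im = d := by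
    have h := congrArg Complex.re hsq
    rw [pow_two, Complex.mul_re] at h
    exact_mod_cast h
  have him : 2 * ((ι (geomSqrt d)).re * (ι (geomSqrt d)).im) = 0 := by
    have h := congrArg Complex.im hsq
    rw [pow_two, Complex.mul_im] at h
    have h' : ((d : ℂ)).im = 0 := by exact_mod_cast Complex.ofReal_im (d : ℝ)
    linarith [h, h']
  have him0 : (ι (geomSqrt d)).im = 0 := by
    by_contra hne
    have hre0 : (ι (geomSqrt d)).re = 0 := by
      rcases mul_eq_zero.1 (by linarith [him] : (ι (geomSqrt d)).re * (ι (geomSqrt d)).im = 0) with h | h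
      · exact h
      · exact absurd h hne
    have hd' : (0 : ℝ) < d := by exact_mod_cast hd
    nlinarith [mul_self_nonneg (ι (geomSqrt d)).im]
  apply ι.injective
  rw [hι]
  exact Complex.conj_eq_iff_im.mpr him0

/-- For a complex conjugation `c ∈ Γ_ℚ` and `d < 0`: `c√d = −√d` (`ι√d` is purely imaginary). [cite: SerreAbelianLadic1968, Ch. I §2.2] -/
theorem smul_geomSqrt_of_isComplexConjugation_of_neg {φ : ℚ →+* ℝ} {c : absoluteGaloisGroup ℚ} (hc : IsComplexConjugation φ c)
    {d : ℚ} (hd : d < 0) : c • geomSqrt d = -geomSqrt d := by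
  obtain ⟨ι, -, hι⟩ := isComplexConjugation_iff.1 hc
  have hsq : ι (geomSqrt d) ^ 2 = (d : ℂ) := by
    rw [← map_pow, geomSqrt_sq]
    simp only [eq_ratCast, map_ratCast]
  have hre : (ι (geomSqrt d)).re * (ι (geomSqrt d)).re - (ι (geomSqrt d)).im * (ι (geomSqrt d)).im = d := by
    have h := congrArg Complex.re hsq
    rw [pow_two, Complex.mul_re] at h
    exact_mod_cast h
  have him : 2 * ((ι (geomSqrt d)).re * (ι (geomSqrt d)).im) = 0 := by
    have h := congrArg Complex.im hsq
    rw [pow_two, Complex.mul_im] at h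
    have h' : ((d : ℂ)).im = 0 := by exact_mod_cast Complex.ofReal_im (d : ℝ)
    linarith [h, h']
  have hre0 : (ι (geomSqrt d)).re = 0 := by
    by_contra hne
    have him0 : (ι (geomSqrt d)).im = 0 := by
      rcases mul_eq_zero.1 (by linarith [him] : (ι (geomSqrt d)).re * (ι (geomSqrt d)).im = 0) with h | h
      · exact absurd h hne
      · exact h
    have hd' : (d : ℝ) < 0 := by exact_mod_cast hd
    nlinarith [mul_self_nonneg (ι (geomSqrt d)).re]
  apply ι.injective
  rw [hι, map_neg]
  exact Complex.ext (by simp [hre0]) (by simp)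

/-- **Every element of the decomposition group at the real place fixes `√d` when `d > 0`** (it is `1` or a complex conjugation,
`isComplexConjugationAt_absGaloisRestrict_of_ne_one`). [cite: SerreAbelianLadic1968, Ch. I §2.2] -/
theorem smul_geomSqrt_of_mem_decompInf_of_pos {d : ℚ} (hd : 0 < d) (w : InfinitePlace ℚ) :
    ∀ g ∈ decompInf w, g • geomSqrt d = geomSqrt d := by
  have hw : w.IsReal := IsTotallyReal.isReal w
  rintro _ ⟨τ, rfl⟩
  by_cases hτ : τ = 1
  · rw [hτ, map_one, one_smul]
  · exact smul_geomSqrt_of_isComplexConjugation_of_pos (isComplexConjugationAt_absGaloisRestrict_of_ne_one (K := ℚ) hw hτ) hd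

/-- For `d < 0` a non-trivial element of the decomposition group at the real place NEGATES `√d`. [cite: SerreAbelianLadic1968, Ch. I §2.2] -/
theorem smul_geomSqrt_of_mem_decompInf_of_neg {d : ℚ} (hd : d < 0) (w : InfinitePlace ℚ) :
    ∀ g ∈ decompInf w, g ≠ 1 → g • geomSqrt d = -geomSqrt d := by
  have hw : w.IsReal := IsTotallyReal.isReal w
  rintro _ ⟨τ, rfl⟩ hne
  have hτ : τ ≠ 1 := by rintro rfl; exact hne (map_one _)
  exact smul_geomSqrt_of_isComplexConjugation_of_neg (isComplexConjugationAt_absGaloisRestrict_of_ne_one (K := ℚ) hw hτ) hd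

end Sqrt

/-! ## §6 Assembly: «`X(·/ℚ_∞)` is `Λ`-torsion with `μ₂ = 0`» (as `Sel_{2^∞}(·/ℚ_∞)[2]` finite) along signed `2^∞`-congruences and
on quadratic-twist families (modulo the printed `im κ_𝔭 ⊇ L_𝔭`) -/

section Assembly

variable (V W : WeierstrassCurve ℚ) [V.IsGloballyMinimal] [V.IsElliptic] [W.IsGloballyMinimal] [W.IsElliptic]
  (κ : ZpExtension ℚ 2) {v : HeightOneSpectrum (𝓞 ℚ)}

/-- **TRANSFER ALONG A SIGNED `2^∞`-CONGRUENCE, `Δ > 0`** (modulo `GreenbergVatsal2000.imKummer_ge_greenbergCondition_at_p`). `V, W/ℚ`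
globally minimal, good ordinary at `2` (`2 ∤ Δ_min`, `2 ∤ a₂`), `Δ_V, Δ_W > 0`, `κ` the cyclotomic `ℤ₂`-extension, `e : V[2^∞] ≃+ W[2^∞]`
additive and sign-equivariant (`e(σm) = ±σe(m)`, the sign depending on `σ` only) and EQUIVARIANT on the decomposition group of the real
place. Then `Sel_{2^∞}(V/ℚ_∞)[2]` is finite iff `Sel_{2^∞}(W/ℚ_∞)[2]` is finite. Proof: the restriction `ψ : V[2] ≃ W[2]` is
`Γ_ℚ`-equivariant (§3), matches the 2-adic letters `C₂ ∩ E[2]` (§1: no sign condition) and the real Kummer letters (§4), so att-p5 g10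
`RealKummerCongruence.finite_twoTorsion_selmerInfty_iff_of_torsionIso_of_GV` applies. [cite: GreenbergVatsal2000, Thm 1.4 and §2 p. 26]
[cite: GreenbergLNM1716, §2 Props. 2.2–2.4, §5 p. 168] -/
theorem finite_twoTorsion_selmerInfty_iff_of_signedPrimaryIso_of_GV
    (hGV : Literature.NumberTheory.EllipticCurves.GreenbergVatsal2000.imKummer_ge_greenbergCondition_at_p)
    (hκ : κ.IsCyclotomic) (hΔpos : 0 < V.Δ) (hΔpos' : 0 < W.Δ)
    (hpv : ((2 : ℕ) : 𝓞 ℚ) ∈ v.asIdeal) (hΔ : ¬ (2 : ℤ) ∣ minimalDiscriminantInt V) (hΔ' : ¬ (2 : ℤ) ∣ minimalDiscriminantInt W)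
    (hord : ¬ (2 : ℤ) ∣ V.frobeniusTrace 2) (hord' : ¬ (2 : ℤ) ∣ W.frobeniusTrace 2)
    (e : ↥(V.geomPrimaryTorsion 2) ≃+ ↥(W.geomPrimaryTorsion 2))
    (he : ∀ σ : absoluteGaloisGroup ℚ, (∀ m, e (σ • m) = σ • e m) ∨ (∀ m, e (σ • m) = -(σ • e m)))
    (w : InfinitePlace ℚ) (hw : ∀ g ∈ decompInf w, ∀ m, e (g • m) = g • e m) :
    Set.Finite {s : V.selmerInfty κ | 2 • s = 0} ↔ Set.Finite {s : W.selmerInfty κ | 2 • s = 0} := by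
  obtain ⟨⟨g, hg⟩, htriv, -⟩ := RealKummerHom.exists_ne_one_and_smul_eq_self_and_mem_ker V κ hκ hΔpos w
  obtain ⟨-, htriv', -⟩ := RealKummerHom.exists_ne_one_and_smul_eq_self_and_mem_ker W κ hκ hΔpos' w
  obtain ⟨N, hN⟩ := RealKummerOrdinary.exists_torsionDatum V 2 hpv hΔ
  obtain ⟨N', hN'⟩ := RealKummerOrdinary.exists_torsionDatum W 2 hpv hΔ'
  obtain ⟨ψ, hψe⟩ := exists_torsionIso_of_primaryIso V W 2 e
  have hψ' : ∀ (σ : absoluteGaloisGroup ℚ) (t : ↥(V.geomTorsion 2)), ψ (σ • t) = σ • ψ t :=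
    torsionIso_smul_of_signEquivariant V W e he ψ hψe
  have hψ : ∀ (x : κ.kerSubgroup) (m : ↥(V.geomTorsion 2)),
      (ψ : ↥(V.geomTorsion 2) →+ ↥(W.geomTorsion 2)) (ContinuousMonoidHom.id κ.kerSubgroup x • m) =
        x • (ψ : ↥(V.geomTorsion 2) →+ ↥(W.geomTorsion 2)) m := fun x m ↦ hψ' x m
  have hplus : ∀ t : ↥(V.geomTorsion 2), t ∈ N.plus ↔ ψ t ∈ N'.plus :=
    mem_plus_iff_of_signEquivariant V W hpv hΔ hΔ' hord hord' e he ψ hψe N N' hN hN'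
  obtain ⟨Tw, -, hline⟩ := RealKummerLine.exists_kummerLetter V κ.kerSubgroup w hΔpos hg
  have hgw : (g : absoluteGaloisGroup ℚ) ∈ decompInf w := (Subgroup.mem_inf.1 g.2).2
  have hline' := kummerLine_iff_of_smul_eq V W e ψ hψe (hw _ hgw) hline
  exact RealKummerCongruence.finite_twoTorsion_selmerInfty_iff_of_torsionIso_of_GV V W κ hGV hκ hΔpos hΔpos' hpv hΔ hΔ' hord hord'
    ψ hψ' hψ N N' hN hN' hplus w htriv htriv' hg hline hline' rfl

/-- **TRANSFER ALONG A SIGNED `2^∞`-CONGRUENCE, `Δ < 0`** (modulo the same print fact): with BOTH discriminants negative there is no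
real letter (att-p5 g10 `RealKummerNegDisc`), so ANY sign-equivariant `e : V[2^∞] ≃+ W[2^∞]` between globally minimal good-ordinary-at-`2`
curves gives `Sel_{2^∞}(V/ℚ_∞)[2]` finite ⟺ `Sel_{2^∞}(W/ℚ_∞)[2]` finite — the `2`-adic letter is matched automatically (§1).
[cite: GreenbergVatsal2000, Thm 1.4 and §2 p. 26] [cite: GreenbergLNM1716, §2 Props. 2.2–2.4, §5 p. 168] -/
theorem finite_twoTorsion_selmerInfty_iff_of_signedPrimaryIso_of_GV_of_Δ_neg
    (hGV : Literature.NumberTheory.EllipticCurves.GreenbergVatsal2000.imKummer_ge_greenbergCondition_at_p)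
    (hκ : κ.IsCyclotomic) (hΔneg : V.Δ < 0) (hΔneg' : W.Δ < 0)
    (hpv : ((2 : ℕ) : 𝓞 ℚ) ∈ v.asIdeal) (hΔ : ¬ (2 : ℤ) ∣ minimalDiscriminantInt V) (hΔ' : ¬ (2 : ℤ) ∣ minimalDiscriminantInt W)
    (hord : ¬ (2 : ℤ) ∣ V.frobeniusTrace 2) (hord' : ¬ (2 : ℤ) ∣ W.frobeniusTrace 2)
    (e : ↥(V.geomPrimaryTorsion 2) ≃+ ↥(W.geomPrimaryTorsion 2))
    (he : ∀ σ : absoluteGaloisGroup ℚ, (∀ m, e (σ • m) = σ • e m) ∨ (∀ m, e (σ • m) = -(σ • e m))) :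
    Set.Finite {s : V.selmerInfty κ | 2 • s = 0} ↔ Set.Finite {s : W.selmerInfty κ | 2 • s = 0} := by
  obtain ⟨N, hN⟩ := RealKummerOrdinary.exists_torsionDatum V 2 hpv hΔ
  obtain ⟨N', hN'⟩ := RealKummerOrdinary.exists_torsionDatum W 2 hpv hΔ'
  obtain ⟨ψ, hψe⟩ := exists_torsionIso_of_primaryIso V W 2 e
  have hψ' : ∀ (σ : absoluteGaloisGroup ℚ) (t : ↥(V.geomTorsion 2)), ψ (σ • t) = σ • ψ t :=
    torsionIso_smul_of_signEquivariant V W e he ψ hψe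
  have hψ : ∀ (x : κ.kerSubgroup) (m : ↥(V.geomTorsion 2)),
      (ψ : ↥(V.geomTorsion 2) →+ ↥(W.geomTorsion 2)) (ContinuousMonoidHom.id κ.kerSubgroup x • m) =
        x • (ψ : ↥(V.geomTorsion 2) →+ ↥(W.geomTorsion 2)) m := fun x m ↦ hψ' x m
  have hplus : ∀ t : ↥(V.geomTorsion 2), t ∈ N.plus ↔ ψ t ∈ N'.plus :=
    mem_plus_iff_of_signEquivariant V W hpv hΔ hΔ' hord hord' e he ψ hψe N N' hN hN'
  exact RealKummerNegDisc.finite_twoTorsion_selmerInfty_iff_of_torsionIso_of_GV_of_Δ_neg V W κ hGV hκ hΔneg hΔneg' hpv hΔ hΔ'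
    hord hord' ψ hψ' hψ N N' hN hN' hplus

omit [V.IsGloballyMinimal] [W.IsGloballyMinimal] [V.IsElliptic] [W.IsElliptic] in
/-- A `ℚ`-model of a quadratic twist has a discriminant of the same sign: `C • V^{(d)} = W`, `d ≠ 0` ⟹ (`Δ_W < 0 ⟺ Δ_V < 0`)
(att-p5 g6 `QuadraticTwist.Δ_neg_iff_of_smul_eq_quadraticTwist`, reoriented). [cite: SilvermanAEC2009, X.5 Cor. 5.4 and III.1 Table 3.1] -/
theorem Δ_neg_iff_of_model_twist {d : ℚ} (hd : d ≠ 0) {C : VariableChange ℚ} (hC : C • V.quadraticTwist d = W) :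
    W.Δ < 0 ↔ V.Δ < 0 :=
  QuadraticTwist.Δ_neg_iff_of_smul_eq_quadraticTwist V W hd (C := C⁻¹) (by rw [← hC, inv_smul_smul])

omit [V.IsGloballyMinimal] [W.IsGloballyMinimal] in
/-- The same for positive discriminants (`Δ ≠ 0` on both sides). [cite: SilvermanAEC2009, X.5 Cor. 5.4 and III.1 Table 3.1] -/
theorem Δ_pos_iff_of_model_twist {d : ℚ} (hd : d ≠ 0) {C : VariableChange ℚ} (hC : C • V.quadraticTwist d = W) :
    0 < W.Δ ↔ 0 < V.Δ := by
  rw [← not_iff_not, ← DiscriminantSign.Δ_neg_iff_not_Δ_pos W, ← DiscriminantSign.Δ_neg_iff_not_Δ_pos V]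
  exact Δ_neg_iff_of_model_twist V W hd hC

/-- **QUADRATIC-TWIST INVARIANCE OF STUB T's CONCLUSION, `Δ > 0`, POSITIVE ADMISSIBLE TWISTS** (modulo the printed `im κ_𝔭 ⊇ L_𝔭`):
`V/ℚ` globally minimal, good ordinary at `2`, `Δ_V > 0`; `W` a globally minimal `ℚ`-model of the quadratic twist `V^{(d)}` (`C • V^{(d)} = W`)
which is again good ordinary at `2` (forces `ℚ(√d)` unramified at `2`), with `d > 0`. Then `Sel_{2^∞}(V/ℚ_∞)[2]` is finite iff
`Sel_{2^∞}(W/ℚ_∞)[2]` is: «`X` `Λ`-torsion with `μ₂ = 0`» holds for `V` iff it holds for `V^{(d)}`. (The twisting isomorphism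
`V[2^∞] ≃ W[2^∞]` is equivariant exactly on the fixer of `√d` — tree `exists_addEquiv_geomPrimaryTorsion_of_model_twist_sign` — and every
element of the real decomposition group fixes `√d` for `d > 0`, §5. A `p = 2` phenomenon: `E^{(d)}[2] ≅ E[2]`; at odd `p` Greenberg–Vatsal's
Thm 1.4 does not relate a curve to its quadratic twists.) [cite: GreenbergVatsal2000, Thm 1.4 and §2 p. 26]
[cite: GreenbergLNM1716, §2 Props. 2.2–2.4, §5 p. 168] [cite: SilvermanAEC2009, X.5 Cor. 5.4] -/
theorem finite_twoTorsion_selmerInfty_iff_of_model_twist_of_pos_of_GV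
    (hGV : Literature.NumberTheory.EllipticCurves.GreenbergVatsal2000.imKummer_ge_greenbergCondition_at_p)
    (hκ : κ.IsCyclotomic) (hΔpos : 0 < V.Δ)
    (hpv : ((2 : ℕ) : 𝓞 ℚ) ∈ v.asIdeal) (hΔ : ¬ (2 : ℤ) ∣ minimalDiscriminantInt V) (hΔ' : ¬ (2 : ℤ) ∣ minimalDiscriminantInt W)
    (hord : ¬ (2 : ℤ) ∣ V.frobeniusTrace 2) (hord' : ¬ (2 : ℤ) ∣ W.frobeniusTrace 2)
    {d : ℚ} (hd : 0 < d) {C : VariableChange ℚ} (hC : C • V.quadraticTwist d = W) :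
    Set.Finite {s : V.selmerInfty κ | 2 • s = 0} ↔ Set.Finite {s : W.selmerInfty κ | 2 • s = 0} := by
  haveI : NeZero (2 : ℚ) := ⟨two_ne_zero⟩
  obtain ⟨e, he, hpos, -⟩ := exists_addEquiv_geomPrimaryTorsion_of_model_twist_sign (p := 2) V hd.ne' ⟨C, hC⟩
  exact finite_twoTorsion_selmerInfty_iff_of_signedPrimaryIso_of_GV V W κ hGV hκ hΔpos ((Δ_pos_iff_of_model_twist V W hd.ne' hC).2 hΔpos)
    hpv hΔ hΔ' hord hord' e he Rat.infinitePlace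
    (fun g hg ↦ hpos g (smul_geomSqrt_of_mem_decompInf_of_pos hd Rat.infinitePlace g hg))

/-- **QUADRATIC-TWIST INVARIANCE OF STUB T's CONCLUSION, `Δ < 0`, EITHER SIGN OF `d`** (modulo the printed `im κ_𝔭 ⊇ L_𝔭`): `V/ℚ` globally
minimal, good ordinary at `2`, `Δ_V < 0`; `W` a globally minimal `ℚ`-model of `V^{(d)}` (`d ≠ 0`), again good ordinary at `2`. Then
`Sel_{2^∞}(V/ℚ_∞)[2]` is finite iff `Sel_{2^∞}(W/ℚ_∞)[2]` is — on the `Δ < 0` half-cell (all twelve certified seeds of crux C2) «`X` torsion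
∧ `μ₂ = 0`» is constant on the whole admissible quadratic-twist family, negative twists included. [cite: GreenbergVatsal2000, Thm 1.4 and §2 p. 26]
[cite: GreenbergLNM1716, §2 Props. 2.2–2.4, §5 p. 168] [cite: SilvermanAEC2009, X.5 Cor. 5.4] -/
theorem finite_twoTorsion_selmerInfty_iff_of_model_twist_of_Δ_neg_of_GV
    (hGV : Literature.NumberTheory.EllipticCurves.GreenbergVatsal2000.imKummer_ge_greenbergCondition_at_p)
    (hκ : κ.IsCyclotomic) (hΔneg : V.Δ < 0)
    (hpv : ((2 : ℕ) : 𝓞 ℚ) ∈ v.asIdeal) (hΔ : ¬ (2 : ℤ) ∣ minimalDiscriminantInt V) (hΔ' : ¬ (2 : ℤ) ∣ minimalDiscriminantInt W)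
    (hord : ¬ (2 : ℤ) ∣ V.frobeniusTrace 2) (hord' : ¬ (2 : ℤ) ∣ W.frobeniusTrace 2)
    {d : ℚ} (hd : d ≠ 0) {C : VariableChange ℚ} (hC : C • V.quadraticTwist d = W) :
    Set.Finite {s : V.selmerInfty κ | 2 • s = 0} ↔ Set.Finite {s : W.selmerInfty κ | 2 • s = 0} := by
  haveI : NeZero (2 : ℚ) := ⟨two_ne_zero⟩
  obtain ⟨e, he, -, -⟩ := exists_addEquiv_geomPrimaryTorsion_of_model_twist_sign (p := 2) V hd ⟨C, hC⟩
  exact finite_twoTorsion_selmerInfty_iff_of_signedPrimaryIso_of_GV_of_Δ_neg V W κ hGV hκ hΔneg ((Δ_neg_iff_of_model_twist V W hd hC).2 hΔneg)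
    hpv hΔ hΔ' hord hord' e he

end Assembly

end Summit.BirchSwinnertonDyer.BirchSwinnertonDyer.Theorems.AlignedTransportAtTwoFineRoad.RealKummerTwist

end
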